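import Summits.KontsevichZagierPeriods.KontsevichZagierPeriods.Theses.RootDecompRationalCubeDichotomy

/-!
# Route RootDecompRationalCubeDichotomy — `RationalCubePiKernelGlue` (item stmt-KontsevichZagierPeriods-26324)

GLUE of the gen-2 split of `RationalCubePiKernel` (24905):
`RationalCubePiKernelSingle → SectorMerge → RationalCubePiKernel`.

Proof (= `ratPiKernel_of_single_of_merge` of the decomp-kz lens-2 node file
`run/shared/lean/pub/decomp-kz/decomp-kz-lens-2/g3/RationalCubeDichotomy.lean`, gen 3): write
`x = ρ + y` with `ρ ∈ relations`, `y` in the rational-cube subgroup; `SectorMerge` gives ONE rational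
cube representation `q` with `y − [q] ∈ relations`; soundness (`relations ≤ ker eval`) turns
`eval x = 0` into `q.value = 0`; `RationalCubePiKernelSingle` gives `N` with `[π]^N [q] ∈ relations`;
the `[π]`-iterate is additive and preserves relations (`piRep_mul_iterate_mem_relations`, two-sided
ideal), so `[π]^N x ∈ relations`. Elementary; standard axioms.
-/

namespace Summit.KontsevichZagierPeriods.RootDecompRationalCubeDichotomy

open Literature.NumberTheory.Transcendental Literature.NumberTheory.Transcendental.KZ

/-- The `[π]`-iterate is additive (each step is left multiplication in the non-unital ring `FormalRep`). -/
theorem piIter_add (K : ℕ) (x y : FormalRep) :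
    (fun y : FormalRep => of piRep * y)^[K] (x + y) =
      (fun y : FormalRep => of piRep * y)^[K] x + (fun y : FormalRep => of piRep * y)^[K] y := by
  induction K generalizing x y with
  | zero => rfl
  | succ K ih => simp only [Function.iterate_succ_apply', ih, mul_add]

/-- **RationalCubePiKernelGlue** (item stmt-KontsevichZagierPeriods-26324):
`RationalCubePiKernelSingle → SectorMerge → RationalCubePiKernel`. -/
theorem rationalCubePiKernelGlue_proof :
    Summit.KontsevichZagierPeriods.KontsevichZagierPeriods.Theses.RootDecompRationalCubeDichotomy.RationalCubePiKernelGlue := by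
  unfold Summit.KontsevichZagierPeriods.KontsevichZagierPeriods.Theses.RootDecompRationalCubeDichotomy.RationalCubePiKernelGlue
    Summit.KontsevichZagierPeriods.KontsevichZagierPeriods.Theses.RootDecompRationalCubeDichotomy.RationalCubePiKernel
  intro h1 hM x hx h0
  obtain ⟨ρ, hρ, y, hy, rfl⟩ := AddSubgroup.mem_sup.mp hx
  obtain ⟨m, q, P, Q, hdom, hQ, hint, hyq⟩ := hM y hy
  have hsound : ∀ {c : FormalRep}, c ∈ relations → eval c = 0 := fun hc =>
    (AddMonoidHom.mem_ker).mp (relations_le_ker_eval_holds hc)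
  have e : ρ + y = (ρ + (y - of q)) + of q := by abel
  have hv : q.value = 0 := by
    rw [e, map_add, hsound (add_mem hρ hyq), zero_add, eval_of] at h0
    exact h0
  obtain ⟨N, hN⟩ := h1 m q P Q hdom hQ hint hv
  refine ⟨N, ?_⟩
  rw [e, piIter_add]
  exact add_mem (piRep_mul_iterate_mem_relations _ (add_mem hρ hyq)) hN

end Summit.KontsevichZagierPeriods.RootDecompRationalCubeDichotomy
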